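import Summits.QuantumFields.YangMills.Theorems.UnitScaleTiltProp7FlatCoercivity
import Literature.MathematicalPhysics.QuantumFieldTheory.Balaban1983to89.B10Eq68TorusRegularity
import Literature.MathematicalPhysics.QuantumFieldTheory.Balaban1983to89.MatrixNorms
import Literature.MathematicalPhysics.QuantumFieldTheory.Balaban1983to89.T3ContinuumYM3Torus
import HarnessLib

/-!
# Route `UnitScaleTilt`, crux K1 child «MinimiserStabilityRegPr» (stmt-QuantumFields-19200), registered stub `stub_prop7From14` (v4 828f5fb4a904d3be;
# leaf V3 «Prop 7 from a background (14)» = `T3Thm1CarrierNative.Prop7From14At`) — sub-lemma V3-D2, part 1/3: COVARIANT TRANSPORT KINEMATICS FOR THE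
# NON-FLAT POINCARÉ–COERCIVITY (unitary conjugation on `M_N(ℂ)`, covariant telescoping along straight contours, the comb-gauge difference estimate)

Cell `ym3-torus` ∕ fleet seat `ym-ust-19200-p1` (HUMAN RULING D-0037, YM ladder rung R3), successor g2.  WHERE THIS SITS.  [Balaban1985Variational] Prop. 7
(p. 299) is proved in print from a background `U₀` satisfying (14) — small PLAQUETTE variables, not small bond variables — through the positivity of the
linearised operator ([Balaban1985BackgroundPropagators] Thm 3.11 p. 416, uniform in `k`).  The predecessor seat landed the FLAT case of the averaging term
(`UnitScaleTiltProp7FlatCoercivity`, p451004); the sequels `UnitScaleTiltProp7CovariantBlockPoincare` ∕ `UnitScaleTiltProp7CovariantCoercivity` prove the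
NON-FLAT case in gauge-invariant form (only the plaquette variables of the background enter), by fixing the comb (axial) gauge BLOCK BY BLOCK with the tree's
axial-gauge bond bound `|V₀,b − 1| ≤ |b₋ − y|₁·a` ([Balaban1985Averaging] pp. 24–25, `B7Prop1Explicit.axial_bond_bound`).  This file supplies the kinematics.

WHAT IS PROVED (sorry-free, no definition; our own statements — [folklore] ∕ cited to the printed step they instantiate; `R(u)X = uXu⁻¹` is the tree's
`B7Eq78Linearization.conjR`, transports are `B10Eq27TorusAxialLog.holT`, the comb contour `Γ_{y,x}` is `B7Prop1Explicit.treeWord`):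
* §1 `M_N(ℂ)` algebra for units `u` with `‖u‖, ‖u⁻¹‖ ≤ 1` (`U1`): `‖u′⁻¹ − u⁻¹‖ ≤ ‖u′ − u‖`, `‖R(u′)X − R(u)X‖ ≤ 2‖u′ − u‖‖X‖`, `‖vg − v′‖ ≤ ‖vgv′⁻¹ − 1‖`, and the
  comparison of the operator norm with the `2N²` real components (`‖M‖² ≤ Σ(Re² + Im²) ≤ N‖M‖²`);
* §2 transports: every transport of a `U1`-valued configuration is in `U1` (`holT_mem`); `y + t·e_μ` is the `t`-fold shift; `V([x, x+(t+1)e_μ]) =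
  V([x, x+te_μ])·V(x+te_μ, x+(t+1)e_μ)` (`holT_replicate_succ`); **COVARIANT TELESCOPING** `R(V([x,x+te_μ]))f(x+te_μ) − f(x) = Σ_{s<t} R(V([x,x+se_μ]))(∇^V_μ f)(x+se_μ)`
  with `(∇^V_μ f)(z) = R(V(z,z+e_μ))f(z+e_μ) − f(z)` the forward covariant derivative of [Balaban1985RegularSpaces] (1.1), and its norm form;
  **`norm_conjR_comb_sub_le`**: `‖R(V(Γ_{ȳ,ȳ+z+e_ν}))X₁ − R(V(Γ_{ȳ,ȳ+z}))X₀‖ ≤ ‖R(V(ȳ+z,ȳ+z+e_ν))X₁ − X₀‖ + 2|z|₁a‖X₀‖` whenever the plaquette variables of `V` are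
  within `a` of `1` — the flat difference of the comb-transported field is the covariant derivative up to the axial-gauge bond defect.

References: T. Bałaban, CMP 98 (1985) 17–51 [Balaban1985Averaging] ((8)–(9) pp.18–19, pp.24–25, (56) p.27); CMP 99 (1985) 75–102 [Balaban1985RegularSpaces]
((1.1) p.76); CMP 99 (1985) 389–434 [Balaban1985BackgroundPropagators] (Thm 3.11 p.416); CMP 102 (1985) 277–309 [Balaban1985Variational] (Prop. 7 p.299, (14) p.280).
-/

noncomputable section

open scoped BigOperators Matrix.Norms.L2Operator

namespace Summit.QuantumFields.YangMills.Theorems.Prop7CovariantCoercivity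

open Literature.MathematicalPhysics.QuantumFieldTheory.Balaban1983to89
open Finset B1RG242Torus
open B7Prop1Explicit renaming Site → LSite
open B7Prop1Explicit (Letter e hol treeWord axialFn disp plaqWord l1 U1 hol_append disp_treeWord gaugeAct axial_bond_bound hol_mem
  disp_replicate)
open B7Eq78Linearization (conjR conjR_apply conjR_sub conjR_add)
open B8Ineq132 (norm_conjR conjR_conjR one_conjR)
open B10Eq27TorusAxialLog (transl transl_zero transl_add transl_add_e pull pull_apply holT holT_append hol_pull hol_pull_zero holT_nil
  holT_cons_true)

variable {N : ℕ} [NeZero N]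

/-! ## §1 Unitary conjugation on `M_N(ℂ)`: three elementary estimates -/

section Algebra

/-- `‖u′⁻¹ − u⁻¹‖ ≤ ‖u′ − u‖` for units of norm `≤ 1` with inverses of norm `≤ 1` (`u′⁻¹ − u⁻¹ = u′⁻¹(u − u′)u⁻¹`). [folklore] -/
theorem norm_inv_sub_inv_le {u u' : (Matrix (Fin N) (Fin N) ℂ)ˣ} (hu : u ∈ U1 (Matrix (Fin N) (Fin N) ℂ))
    (hu' : u' ∈ U1 (Matrix (Fin N) (Fin N) ℂ)) :
    ‖((u'⁻¹ : (Matrix (Fin N) (Fin N) ℂ)ˣ) : Matrix (Fin N) (Fin N) ℂ) - ((u⁻¹ : (Matrix (Fin N) (Fin N) ℂ)ˣ) : Matrix (Fin N) (Fin N) ℂ)‖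
      ≤ ‖(u' : Matrix (Fin N) (Fin N) ℂ) - (u : Matrix (Fin N) (Fin N) ℂ)‖ := by
  have hid : ((u'⁻¹ : (Matrix (Fin N) (Fin N) ℂ)ˣ) : Matrix (Fin N) (Fin N) ℂ) - ((u⁻¹ : (Matrix (Fin N) (Fin N) ℂ)ˣ) : Matrix (Fin N) (Fin N) ℂ)
      = ((u'⁻¹ : (Matrix (Fin N) (Fin N) ℂ)ˣ) : Matrix (Fin N) (Fin N) ℂ) * ((u : Matrix (Fin N) (Fin N) ℂ) - (u' : Matrix (Fin N) (Fin N) ℂ))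
          * ((u⁻¹ : (Matrix (Fin N) (Fin N) ℂ)ˣ) : Matrix (Fin N) (Fin N) ℂ) := by
    rw [mul_sub, sub_mul, Units.inv_mul, one_mul, mul_assoc, Units.mul_inv, mul_one]
  rw [hid]
  calc _ ≤ ‖((u'⁻¹ : (Matrix (Fin N) (Fin N) ℂ)ˣ) : Matrix (Fin N) (Fin N) ℂ)‖ * ‖(u : Matrix (Fin N) (Fin N) ℂ) - (u' : Matrix (Fin N) (Fin N) ℂ)‖
        * ‖((u⁻¹ : (Matrix (Fin N) (Fin N) ℂ)ˣ) : Matrix (Fin N) (Fin N) ℂ)‖ :=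
        (norm_mul_le _ _).trans (mul_le_mul_of_nonneg_right (norm_mul_le _ _) (norm_nonneg _))
    _ ≤ 1 * ‖(u : Matrix (Fin N) (Fin N) ℂ) - (u' : Matrix (Fin N) (Fin N) ℂ)‖ * 1 := by
        gcongr
        · exact hu'.2
        · exact hu.2
    _ = _ := by rw [one_mul, mul_one, norm_sub_rev]

/-- `‖R(u′)X − R(u)X‖ ≤ 2‖u′ − u‖·‖X‖` (`R(u)X = uXu⁻¹`; `u′Xu′⁻¹ − uXu⁻¹ = (u′ − u)Xu′⁻¹ + uX(u′⁻¹ − u⁻¹)`). [cite: Balaban1985Averaging, (56) p.27] -/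
theorem norm_conjR_sub_conjR_le {u u' : (Matrix (Fin N) (Fin N) ℂ)ˣ} (hu : u ∈ U1 (Matrix (Fin N) (Fin N) ℂ))
    (hu' : u' ∈ U1 (Matrix (Fin N) (Fin N) ℂ)) (X : Matrix (Fin N) (Fin N) ℂ) :
    ‖conjR u' X - conjR u X‖ ≤ 2 * ‖(u' : Matrix (Fin N) (Fin N) ℂ) - (u : Matrix (Fin N) (Fin N) ℂ)‖ * ‖X‖ := by
  rw [conjR_apply, conjR_apply]
  have hid : (u' : Matrix (Fin N) (Fin N) ℂ) * X * ((u'⁻¹ : (Matrix (Fin N) (Fin N) ℂ)ˣ) : Matrix (Fin N) (Fin N) ℂ)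
        - (u : Matrix (Fin N) (Fin N) ℂ) * X * ((u⁻¹ : (Matrix (Fin N) (Fin N) ℂ)ˣ) : Matrix (Fin N) (Fin N) ℂ)
      = ((u' : Matrix (Fin N) (Fin N) ℂ) - (u : Matrix (Fin N) (Fin N) ℂ)) * X * ((u'⁻¹ : (Matrix (Fin N) (Fin N) ℂ)ˣ) : Matrix (Fin N) (Fin N) ℂ)
        + (u : Matrix (Fin N) (Fin N) ℂ) * X
          * (((u'⁻¹ : (Matrix (Fin N) (Fin N) ℂ)ˣ) : Matrix (Fin N) (Fin N) ℂ) - ((u⁻¹ : (Matrix (Fin N) (Fin N) ℂ)ˣ) : Matrix (Fin N) (Fin N) ℂ)) := by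
    noncomm_ring
  rw [hid]
  have h1 : ‖((u' : Matrix (Fin N) (Fin N) ℂ) - (u : Matrix (Fin N) (Fin N) ℂ)) * X * ((u'⁻¹ : (Matrix (Fin N) (Fin N) ℂ)ˣ) : Matrix (Fin N) (Fin N) ℂ)‖
      ≤ ‖(u' : Matrix (Fin N) (Fin N) ℂ) - (u : Matrix (Fin N) (Fin N) ℂ)‖ * ‖X‖ := by
    calc _ ≤ ‖(u' : Matrix (Fin N) (Fin N) ℂ) - (u : Matrix (Fin N) (Fin N) ℂ)‖ * ‖X‖ * ‖((u'⁻¹ : (Matrix (Fin N) (Fin N) ℂ)ˣ) : Matrix (Fin N) (Fin N) ℂ)‖ :=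
          (norm_mul_le _ _).trans (mul_le_mul_of_nonneg_right (norm_mul_le _ _) (norm_nonneg _))
      _ ≤ ‖(u' : Matrix (Fin N) (Fin N) ℂ) - (u : Matrix (Fin N) (Fin N) ℂ)‖ * ‖X‖ * 1 := by gcongr; exact hu'.2
      _ = _ := mul_one _
  have h2 : ‖(u : Matrix (Fin N) (Fin N) ℂ) * X
          * (((u'⁻¹ : (Matrix (Fin N) (Fin N) ℂ)ˣ) : Matrix (Fin N) (Fin N) ℂ) - ((u⁻¹ : (Matrix (Fin N) (Fin N) ℂ)ˣ) : Matrix (Fin N) (Fin N) ℂ))‖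
      ≤ ‖(u' : Matrix (Fin N) (Fin N) ℂ) - (u : Matrix (Fin N) (Fin N) ℂ)‖ * ‖X‖ := by
    calc _ ≤ ‖(u : Matrix (Fin N) (Fin N) ℂ)‖ * ‖X‖
          * ‖((u'⁻¹ : (Matrix (Fin N) (Fin N) ℂ)ˣ) : Matrix (Fin N) (Fin N) ℂ) - ((u⁻¹ : (Matrix (Fin N) (Fin N) ℂ)ˣ) : Matrix (Fin N) (Fin N) ℂ)‖ :=
          (norm_mul_le _ _).trans (mul_le_mul_of_nonneg_right (norm_mul_le _ _) (norm_nonneg _))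
      _ ≤ 1 * ‖X‖ * ‖(u' : Matrix (Fin N) (Fin N) ℂ) - (u : Matrix (Fin N) (Fin N) ℂ)‖ := by
          gcongr
          · exact hu.1
          · exact norm_inv_sub_inv_le hu hu'
      _ = _ := by ring
  calc _ ≤ _ := norm_add_le _ _
    _ ≤ _ := add_le_add h1 h2
    _ = _ := by ring

/-- `‖vg − v′‖ ≤ ‖vgv′⁻¹ − 1‖` for `‖v′‖ ≤ 1` (`vg − v′ = (vgv′⁻¹ − 1)v′`). [folklore] -/
theorem norm_mul_sub_le_norm_conj_sub_one (v g : Matrix (Fin N) (Fin N) ℂ) {v' : (Matrix (Fin N) (Fin N) ℂ)ˣ}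
    (hv' : v' ∈ U1 (Matrix (Fin N) (Fin N) ℂ)) :
    ‖v * g - (v' : Matrix (Fin N) (Fin N) ℂ)‖ ≤ ‖v * g * ((v'⁻¹ : (Matrix (Fin N) (Fin N) ℂ)ˣ) : Matrix (Fin N) (Fin N) ℂ) - 1‖ := by
  have hid : v * g - (v' : Matrix (Fin N) (Fin N) ℂ)
      = (v * g * ((v'⁻¹ : (Matrix (Fin N) (Fin N) ℂ)ˣ) : Matrix (Fin N) (Fin N) ℂ) - 1) * (v' : Matrix (Fin N) (Fin N) ℂ) := by
    rw [sub_mul, one_mul, mul_assoc (v * g), Units.inv_mul, mul_one]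
  rw [hid]
  calc _ ≤ ‖v * g * ((v'⁻¹ : (Matrix (Fin N) (Fin N) ℂ)ˣ) : Matrix (Fin N) (Fin N) ℂ) - 1‖ * ‖(v' : Matrix (Fin N) (Fin N) ℂ)‖ := norm_mul_le _ _
    _ ≤ ‖v * g * ((v'⁻¹ : (Matrix (Fin N) (Fin N) ℂ)ˣ) : Matrix (Fin N) (Fin N) ℂ) - 1‖ * 1 := by gcongr; exact hv'.1
    _ = _ := mul_one _

omit [NeZero N] in
/-- `‖M‖² ≤ Σ_{j,k} ((Re M_jk)² + (Im M_jk)²)` (operator norm ≤ Hilbert–Schmidt norm; tree `MatrixNorms.opNorm_sq_le_sum_norm_sq`). [folklore] -/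
theorem opNorm_sq_le_sum_re_sq_add_im_sq (M : Matrix (Fin N) (Fin N) ℂ) :
    ‖M‖ ^ 2 ≤ ∑ j : Fin N, ∑ k : Fin N, ((M j k).re ^ 2 + (M j k).im ^ 2) := by
  refine (MatrixNorms.opNorm_sq_le_sum_norm_sq M).trans (le_of_eq ?_)
  refine Finset.sum_congr rfl fun j _ => Finset.sum_congr rfl fun k _ => ?_
  rw [Complex.sq_norm, Complex.normSq_apply]; ring

omit [NeZero N] in
/-- `Σ_{j,k} ((Re M_jk)² + (Im M_jk)²) ≤ N·‖M‖²` (each column is bounded by the operator norm; tree `MatrixNorms.sum_norm_sq_col_le_opNorm_sq`). [folklore] -/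
theorem sum_re_sq_add_im_sq_le_mul_opNorm_sq (M : Matrix (Fin N) (Fin N) ℂ) :
    ∑ j : Fin N, ∑ k : Fin N, ((M j k).re ^ 2 + (M j k).im ^ 2) ≤ N * ‖M‖ ^ 2 := by
  have h : ∀ k : Fin N, ∑ j : Fin N, ((M j k).re ^ 2 + (M j k).im ^ 2) ≤ ‖M‖ ^ 2 := by
    intro k
    refine (le_of_eq ?_).trans (MatrixNorms.sum_norm_sq_col_le_opNorm_sq M k)
    refine Finset.sum_congr rfl fun j _ => ?_
    rw [Complex.sq_norm, Complex.normSq_apply]; ring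
  rw [Finset.sum_comm]
  calc ∑ k : Fin N, ∑ j : Fin N, ((M j k).re ^ 2 + (M j k).im ^ 2) ≤ ∑ _k : Fin N, ‖M‖ ^ 2 := Finset.sum_le_sum fun k _ => h k
    _ = N * ‖M‖ ^ 2 := by simp

end Algebra

/-! ## §2 Transports of a unitary background: membership, the line transport, the comb transport -/

section Transport

variable {P : Params} {i : ℕ}

/-- Every torus transport of a `U1`-valued configuration is in `U1`. [folklore] -/
theorem holT_mem {V : GaugeField P i (Matrix (Fin N) (Fin N) ℂ)ˣ} (hV : ∀ b, V b ∈ U1 (Matrix (Fin N) (Fin N) ℂ)) (x : Site P i)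
    (w : List (Letter P.d)) : holT V x w ∈ U1 (Matrix (Fin N) (Fin N) ℂ) := by
  rw [← hol_pull_zero]
  exact hol_mem (V := pull V x) (fun z κ => hV _) 0 w

/-- The translate by `t·e_μ` is the `t`-fold unit shift. [folklore] -/
theorem transl_natSmul_e (x : Site P i) (μ : Fin P.d) (t : ℕ) :
    transl x ((t : ℤ) • e μ) = (fun z : Site P i => z.shift μ)^[t] x := by
  induction t with
  | zero => simp
  | succ t ih =>
    rw [Function.iterate_succ_apply', ← ih, ← transl_add_e, Nat.cast_succ, add_smul, one_smul]

omit [NeZero N] in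
/-- The straight contour of `t + 1` steps is the contour of `t` steps followed by one bond:
`V([x, x + (t+1)e_μ]) = V([x, x + te_μ])·V(x + te_μ, x + (t+1)e_μ)`. [cite: Balaban1985Averaging, (9) p.18] -/
theorem holT_replicate_succ (V : GaugeField P i (Matrix (Fin N) (Fin N) ℂ)ˣ) (x : Site P i) (μ : Fin P.d) (t : ℕ) :
    holT V x (List.replicate (t + 1) (μ, true))
      = holT V x (List.replicate t (μ, true)) * V ⟨(fun z : Site P i => z.shift μ)^[t] x, μ⟩ := by
  rw [List.replicate_succ', holT_append, disp_replicate, B7Prop1Explicit.Letter.vec_true, transl_natSmul_e]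
  simp

omit [NeZero N] in
/-- **COVARIANT TELESCOPING ALONG A STRAIGHT CONTOUR**: `R(V([x, x+te_μ]))f(x + te_μ) − f(x) = Σ_{s<t} R(V([x, x+se_μ]))(∇^V_μ f)(x + se_μ)`,
`(∇^V_μ f)(z) = R(V(z, z+e_μ))f(z + e_μ) − f(z)` the forward covariant derivative of [Balaban1985RegularSpaces] (1.1). [cite: Balaban1985RegularSpaces, (1.1) p.76] -/
theorem conjR_holT_replicate_sub_eq_sum (V : GaugeField P i (Matrix (Fin N) (Fin N) ℂ)ˣ) (f : Site P i → Matrix (Fin N) (Fin N) ℂ)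
    (x : Site P i) (μ : Fin P.d) (t : ℕ) :
    conjR (holT V x (List.replicate t (μ, true))) (f ((fun z : Site P i => z.shift μ)^[t] x)) - f x
      = ∑ s ∈ range t, conjR (holT V x (List.replicate s (μ, true)))
          (conjR (V ⟨(fun z : Site P i => z.shift μ)^[s] x, μ⟩) (f (((fun z : Site P i => z.shift μ)^[s] x).shift μ))
            - f ((fun z : Site P i => z.shift μ)^[s] x)) := by
  induction t with
  | zero => simp
  | succ t ih =>
    rw [Finset.sum_range_succ, ← ih, holT_replicate_succ, ← conjR_conjR, conjR_sub, Function.iterate_succ_apply']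
    abel

/-- Its norm form: `‖R(V([x, x+te_μ]))f(x + te_μ) − f(x)‖ ≤ Σ_{s<t} ‖(∇^V_μ f)(x + se_μ)‖` (conjugation by a unitary is an isometry).
[cite: Balaban1985RegularSpaces, (1.1) p.76] -/
theorem norm_conjR_holT_replicate_sub_le {V : GaugeField P i (Matrix (Fin N) (Fin N) ℂ)ˣ} (hV : ∀ b, V b ∈ U1 (Matrix (Fin N) (Fin N) ℂ))
    (f : Site P i → Matrix (Fin N) (Fin N) ℂ) (x : Site P i) (μ : Fin P.d) (t : ℕ) :
    ‖conjR (holT V x (List.replicate t (μ, true))) (f ((fun z : Site P i => z.shift μ)^[t] x)) - f x‖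
      ≤ ∑ s ∈ range t, ‖conjR (V ⟨(fun z : Site P i => z.shift μ)^[s] x, μ⟩) (f (((fun z : Site P i => z.shift μ)^[s] x).shift μ))
            - f ((fun z : Site P i => z.shift μ)^[s] x)‖ := by
  rw [conjR_holT_replicate_sub_eq_sum]
  refine (norm_sum_le _ _).trans (le_of_eq (Finset.sum_congr rfl fun s _ => ?_))
  exact norm_conjR (holT_mem hV x _) _

/-- **THE COMB-GAUGE DIFFERENCE ESTIMATE**: with `v(z) = V(Γ_{ȳ, ȳ+z})` the transport along the comb contour from `ȳ` ([Balaban1985Averaging] p. 24) and the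
plaquette variables of `V` within `a` of `1`: `‖R(v(z + e_ν))X₁ − R(v(z))X₀‖ ≤ ‖R(V(ȳ+z, ȳ+z+e_ν))X₁ − X₀‖ + 2|z|₁a·‖X₀‖` — the flat difference of the
comb-transported field is the covariant derivative up to the axial-gauge bond defect `|V₀,b − 1| ≤ |b₋ − y|₁α` (tree `B7Prop1Explicit.axial_bond_bound`).
[cite: Balaban1985Averaging, pp.24–25] -/
theorem norm_conjR_comb_sub_le {V : GaugeField P i (Matrix (Fin N) (Fin N) ℂ)ˣ} (hV : ∀ b, V b ∈ U1 (Matrix (Fin N) (Fin N) ℂ)) {a : ℝ}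
    (ha : 0 ≤ a) (hplaq : ∀ (x : Site P i) (κ μ : Fin P.d), κ ≠ μ → ‖((holT V x (plaqWord κ μ) : (Matrix (Fin N) (Fin N) ℂ)ˣ) : Matrix (Fin N) (Fin N) ℂ) - 1‖ ≤ a)
    (ybar : Site P i) (z : LSite P.d) (ν : Fin P.d) (X₀ X₁ : Matrix (Fin N) (Fin N) ℂ) :
    ‖conjR (holT V ybar (treeWord (z + e ν))) X₁ - conjR (holT V ybar (treeWord z)) X₀‖
      ≤ ‖conjR (V ⟨transl ybar z, ν⟩) X₁ - X₀‖ + 2 * (l1 z * a) * ‖X₀‖ := by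
  -- the axial-gauge bond defect on `ℤ^d` for the pullback based at `ȳ`
  set W : LSite P.d → Fin P.d → (Matrix (Fin N) (Fin N) ℂ)ˣ := pull V ybar with hW
  have hWm : ∀ x κ, W x κ ∈ U1 (Matrix (Fin N) (Fin N) ℂ) := fun x κ => hV _
  have h44 : ∀ (x : LSite P.d) (κ μ : Fin P.d), κ ≠ μ → ‖((hol W x (plaqWord κ μ) : (Matrix (Fin N) (Fin N) ℂ)ˣ) : Matrix (Fin N) (Fin N) ℂ) - 1‖ ≤ a := by
    intro x κ μ hne
    rw [hW, hol_pull]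
    exact hplaq _ κ μ hne
  have hbond := axial_bond_bound W hWm 0 h44 ha z ν
  rw [sub_zero] at hbond
  -- names
  set v₀ : (Matrix (Fin N) (Fin N) ℂ)ˣ := holT V ybar (treeWord z) with hv₀
  set v₁ : (Matrix (Fin N) (Fin N) ℂ)ˣ := holT V ybar (treeWord (z + e ν)) with hv₁
  set g : (Matrix (Fin N) (Fin N) ℂ)ˣ := V ⟨transl ybar z, ν⟩ with hg
  have hv₀' : axialFn W 0 z = v₀ := by rw [axialFn, sub_zero, hW, hol_pull_zero]
  have hv₁' : axialFn W 0 (z + e ν) = v₁ := by rw [axialFn, sub_zero, hW, hol_pull_zero]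
  have hg' : W z ν = g := by rw [hW, pull_apply]
  have hga : gaugeAct (axialFn W 0) W z ν = v₀ * g * v₁⁻¹ := by
    rw [gaugeAct, hv₀', hv₁', hg']
  rw [hga] at hbond
  have hv₀m : v₀ ∈ U1 (Matrix (Fin N) (Fin N) ℂ) := holT_mem hV _ _
  have hv₁m : v₁ ∈ U1 (Matrix (Fin N) (Fin N) ℂ) := holT_mem hV _ _
  have hgm : g ∈ U1 (Matrix (Fin N) (Fin N) ℂ) := hV _
  -- `‖w − g⁻¹‖ ≤ |z|₁ a` for `w = v₁⁻¹ v₀`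
  have hw : ‖((v₁⁻¹ * v₀ : (Matrix (Fin N) (Fin N) ℂ)ˣ) : Matrix (Fin N) (Fin N) ℂ) - ((g⁻¹ : (Matrix (Fin N) (Fin N) ℂ)ˣ) : Matrix (Fin N) (Fin N) ℂ)‖
      ≤ l1 z * a := by
    have hid : ((v₁⁻¹ * v₀ : (Matrix (Fin N) (Fin N) ℂ)ˣ) : Matrix (Fin N) (Fin N) ℂ) - ((g⁻¹ : (Matrix (Fin N) (Fin N) ℂ)ˣ) : Matrix (Fin N) (Fin N) ℂ)
        = ((v₁⁻¹ : (Matrix (Fin N) (Fin N) ℂ)ˣ) : Matrix (Fin N) (Fin N) ℂ) * ((v₀ : Matrix (Fin N) (Fin N) ℂ) * (g : Matrix (Fin N) (Fin N) ℂ) - (v₁ : Matrix (Fin N) (Fin N) ℂ))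
            * ((g⁻¹ : (Matrix (Fin N) (Fin N) ℂ)ˣ) : Matrix (Fin N) (Fin N) ℂ) := by
      rw [Units.val_mul]
      calc _ = ((v₁⁻¹ : (Matrix (Fin N) (Fin N) ℂ)ˣ) : Matrix (Fin N) (Fin N) ℂ) * (v₀ : Matrix (Fin N) (Fin N) ℂ)
            * ((g : Matrix (Fin N) (Fin N) ℂ) * ((g⁻¹ : (Matrix (Fin N) (Fin N) ℂ)ˣ) : Matrix (Fin N) (Fin N) ℂ))
            - ((v₁⁻¹ : (Matrix (Fin N) (Fin N) ℂ)ˣ) : Matrix (Fin N) (Fin N) ℂ) * (v₁ : Matrix (Fin N) (Fin N) ℂ)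
              * ((g⁻¹ : (Matrix (Fin N) (Fin N) ℂ)ˣ) : Matrix (Fin N) (Fin N) ℂ) := by
            rw [Units.mul_inv, Units.inv_mul, mul_one, one_mul]
        _ = _ := by noncomm_ring
    rw [hid]
    calc _ ≤ ‖((v₁⁻¹ : (Matrix (Fin N) (Fin N) ℂ)ˣ) : Matrix (Fin N) (Fin N) ℂ)‖
            * ‖(v₀ : Matrix (Fin N) (Fin N) ℂ) * (g : Matrix (Fin N) (Fin N) ℂ) - (v₁ : Matrix (Fin N) (Fin N) ℂ)‖
            * ‖((g⁻¹ : (Matrix (Fin N) (Fin N) ℂ)ˣ) : Matrix (Fin N) (Fin N) ℂ)‖ :=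
          (norm_mul_le _ _).trans (mul_le_mul_of_nonneg_right (norm_mul_le _ _) (norm_nonneg _))
      _ ≤ 1 * ‖(v₀ : Matrix (Fin N) (Fin N) ℂ) * (g : Matrix (Fin N) (Fin N) ℂ) - (v₁ : Matrix (Fin N) (Fin N) ℂ)‖ * 1 := by
          gcongr
          · exact hv₁m.2
          · exact hgm.2
      _ = ‖(v₀ : Matrix (Fin N) (Fin N) ℂ) * (g : Matrix (Fin N) (Fin N) ℂ) - (v₁ : Matrix (Fin N) (Fin N) ℂ)‖ := by ring
      _ ≤ ‖(v₀ : Matrix (Fin N) (Fin N) ℂ) * (g : Matrix (Fin N) (Fin N) ℂ) * ((v₁⁻¹ : (Matrix (Fin N) (Fin N) ℂ)ˣ) : Matrix (Fin N) (Fin N) ℂ) - 1‖ :=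
          norm_mul_sub_le_norm_conj_sub_one _ _ hv₁m
      _ ≤ l1 z * a := by
          have : ((v₀ * g * v₁⁻¹ : (Matrix (Fin N) (Fin N) ℂ)ˣ) : Matrix (Fin N) (Fin N) ℂ)
              = (v₀ : Matrix (Fin N) (Fin N) ℂ) * (g : Matrix (Fin N) (Fin N) ℂ) * ((v₁⁻¹ : (Matrix (Fin N) (Fin N) ℂ)ˣ) : Matrix (Fin N) (Fin N) ℂ) := by
            rw [Units.val_mul, Units.val_mul]
          rw [← this]
          exact_mod_cast hbond
  -- `R(v₁)X₁ − R(v₀)X₀ = R(v₁)(X₁ − R(w)X₀)`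
  have hfac : conjR v₁ X₁ - conjR v₀ X₀ = conjR v₁ (X₁ - conjR (v₁⁻¹ * v₀) X₀) := by
    rw [conjR_sub, conjR_conjR, ← mul_assoc, mul_inv_cancel, one_mul]
  rw [hfac, norm_conjR hv₁m]
  -- `‖X₁ − R(w)X₀‖ ≤ ‖X₁ − R(g⁻¹)X₀‖ + ‖R(g⁻¹)X₀ − R(w)X₀‖`
  have htri : ‖X₁ - conjR (v₁⁻¹ * v₀) X₀‖ ≤ ‖X₁ - conjR g⁻¹ X₀‖ + ‖conjR g⁻¹ X₀ - conjR (v₁⁻¹ * v₀) X₀‖ := by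
    have : X₁ - conjR (v₁⁻¹ * v₀) X₀ = (X₁ - conjR g⁻¹ X₀) + (conjR g⁻¹ X₀ - conjR (v₁⁻¹ * v₀) X₀) := by abel
    rw [this]; exact norm_add_le _ _
  have h1 : ‖X₁ - conjR g⁻¹ X₀‖ = ‖conjR g X₁ - X₀‖ := by
    rw [← norm_conjR hgm (X₁ - conjR g⁻¹ X₀), conjR_sub, conjR_conjR, mul_inv_cancel, one_conjR]
  have h2 : ‖conjR g⁻¹ X₀ - conjR (v₁⁻¹ * v₀) X₀‖ ≤ 2 * (l1 z * a) * ‖X₀‖ := by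
    rw [norm_sub_rev]
    refine (norm_conjR_sub_conjR_le ((U1 _).inv_mem hgm) ((U1 _).mul_mem ((U1 _).inv_mem hv₁m) hv₀m) X₀).trans ?_
    have hX : 0 ≤ ‖X₀‖ := norm_nonneg _
    nlinarith [hw]
  linarith [htri, h1, h2]

end Transport

end Summit.QuantumFields.YangMills.Theorems.Prop7CovariantCoercivity

end
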